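import Literature.IUT.HodgeArakelov.CohomologyLimitRestriction

/-!
# The inflation SECTION of the restriction `lim_K H¹(H|_K, A) → lim_K H¹(D|_K, A)` to a subgroup `D ≤ H`
# that retracts the levels ([IUTchII] Cor. 1.12 (c)/(ii): the unit classes `M^×_TM(Π)` inside the first line
# `lim_J H¹(Π_Ÿ(Π)|_J, (l·Δ_Θ)(Π))` AND inside the target of "restriction to `D ⊆ Π_Ÿ(Π)`")

abc-iut cell, D-0067 wave 4 (seat abc-iut-w4-d043 gen 2; L6-lead ruling §F v1.18c (1) «GO d043 model-Ev
(inflation section)», SUBDAG `plan/L6/SUBDAG-IUTchII-Cor-112.md` rows Cor-112.0.r1 / Cor-112.ii.r13). Companion to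
abc-iut-L6-t1's `CohomologySystemOfContH1.lean` (p411226: the [IUTchII] Prop. 1.4 interface `CohomologySystem`
instantiated from L2's continuous `ContH1`, `h1Lim φ A H ⊥ = lim_K H¹(H ⊓ K, A)`) and to
`CohomologyLimitRestriction.lean` (p411724: `h1LimRestrict`, the restriction of the limits along `D ≤ H`).

S. Mochizuki, *Inter-universal Teichmüller theory II*, kurims manuscript (Dec. 2020), Cor. 1.12 p. 56 (c): "one has
a natural inclusion `M^×_TM(Π) ↪ lim_J H¹(J, (l·Δ_Θ)(Π))`, hence a natural inclusion of `M^×_TM(Π)` into the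
inductive limit of the first line [`lim_J H¹(Π_Ÿ(Π)|_J, (l·Δ_Θ)(Π))`]", and (ii) p. 57: "restriction to the
subgroup `D ⊆ Π_Ÿ(Π)` determines [the horizontal arrows in] a commutative diagram
`{M^×_TM·∞θ(Π)}^ι → M^×_TM(Π) (⊆ lim_J H¹(J, (l·Δ_Θ)(Π)))`". Claim key `Mochizuki2012` (D-0012, DISPUTED); the
CONSTRUCTION below is generic group cohomology [cite: NeukirchSchmidtWingberg2008, I §5] over the landed files;
nothing here takes a side on [IUTchIII] Cor. 3.12.

WHY. abc-iut-L6-t1's frozen `ConstantMultipleRigidity.lean` (CMR v2, p410537) types the theta-evaluation DATA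
`ThetaEvaluation` with a group `Hd` ("`lim_J H¹(J, (l·Δ_Θ)(Π))`", containing `M^×_TM(Π)`), an INJECTION
`inclHd : Hd ↪ lim_J H¹(Π_Ÿ(Π)|_J, ·)` and a TOTAL homomorphism `resD : lim_J H¹(Π_Ÿ(Π)|_J, ·) → Hd` (restriction
to the decomposition group `D = D_{μ_-}`). Print's arrow is restriction to `D` FOLLOWED BY the identification of the
Kummer classes of constants on `D ↠ G_k` with those on `Π` (both receive `O^×_{k̄}` injectively). The canonical
total instantiation (census of abc-iut-w4-d043, STATUS 2026-08-26): `Hd := lim_K H¹(D|_K, ·)`, `resD :=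
h1LimRestrict` (p411724), and `inclHd :=` THE INFLATION SECTION of `resD` constructed here — at each finite-index
open level `K`, pull a class on `D ∩ K` back along the RETRACTION `Π_Ÿ(Π) ∩ K′ → D ∩ K` (`K′ := K ∩ q⁻¹(q(D ∩ K))`,
`k ↦` the unique `d` with `q(d) = q(k)`, `q : Π ↠ G_k` the augmentation; available because `D ∩ Ker(q) = 1` — `D` is
the decomposition group of a closed point — and `Ker(q)` acts trivially on `(l·Δ_Θ)(Π)` — `Δ_Θ` is central in
`Δ^Θ`, [EtTh] §1 p. 12), then pass to the limit. This file is GENERIC: the retractions enter as explicit DATA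
(`LevelRetraction`, every field a printed-shape condition; no `Prop`-valued definition), and we construct
* `retractCocycle` / `retractH1` — pull-back of continuous `H¹` along a continuous homomorphism `ψ : K → L` of
  subgroups under which `k` and `ψ k` act identically on the coefficients;
* `LevelRetraction.sectionGmod`, **`LevelRetraction.h1LimSection : h1Lim φ A D ⊥ →+ h1Lim φ A H ⊥`** (by the
  universal property of the direct limit), `h1LimSection_of`;
* **`LevelRetraction.h1LimRestrict_h1LimSection`** — it IS a section: `h1LimRestrict ∘ h1LimSection = id`;
  hence `h1LimSection_injective` ("natural inclusion … into the inductive limit of the first line") and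
  `h1LimRestrict_surjective`.
The model retraction data (from the augmentation, compactness of `D`, `T₂` of `G_k`) and the `ThetaEvaluation`
instance over abc-iut-w4-d030's `EtaleLevels.thetaEnvData` (with `MxTM :=` the image of `O^×` under
abc-iut-w4-d007's `h1LimKummer` at `H := D`, p416543) are the announced follow-ups. Typed ≠ discharged.
-/

namespace Literature.IUT.HodgeArakelov

open Literature.AnabelianGeometry.EtaleTheta CohomologySystemOfContH1

universe u

noncomputable section

variable {P : TopGroup.{u}} {G' : Type u} [Group G'] [TopologicalSpace G'] [IsTopologicalGroup G']
  (φ : P →* G') (A : Subgroup G') [A.Normal] [IsMulCommutative A]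

namespace CohomologySystemOfContH1

open scoped IsMulCommutative

/-! ### Pull-back of continuous `H¹` along a retraction of subgroups -/

/-- Pull-back of continuous cocycles along a continuous homomorphism `ψ : K → L` between subgroups of `Π` under
which `k` and `ψ(k)` act IDENTICALLY on the coefficients `A` (at the model: `k · ψ(k)⁻¹ ∈ Ker(Π ↠ G_k)`, which acts
trivially on `(l·Δ_Θ)(Π)`): `f ↦ f ∘ ψ`. [cite: NeukirchSchmidtWingberg2008, I §5] -/
def retractCocycle {K L : Subgroup P} (ψ : K →* L) (hψc : Continuous ψ)
    (hψ : ∀ (k : K) (a : A), MulAut.conjNormal (φ ((ψ k : L) : P)) a = MulAut.conjNormal (φ (k : P)) a) :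
    contCocycles φ A L →* contCocycles φ A K where
  toFun f := ⟨fun k => f.1 (ψ k), f.2.1.comp hψc, fun k k' => by
      change f.1 (ψ (k * k')) = f.1 (ψ k) * MulAut.conjNormal (φ (k : P)) (f.1 (ψ k'))
      rw [map_mul, f.2.2, hψ]⟩
  map_one' := rfl
  map_mul' _ _ := rfl

/-- **Pull-back `H¹(L, A) → H¹(K, A)`** along `ψ : K → L` as in `retractCocycle` (coboundaries go to
coboundaries because `k` and `ψ(k)` act identically on `A`). [cite: NeukirchSchmidtWingberg2008, I §5] -/
def retractH1 {K L : Subgroup P} (ψ : K →* L) (hψc : Continuous ψ)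
    (hψ : ∀ (k : K) (a : A), MulAut.conjNormal (φ ((ψ k : L) : P)) a = MulAut.conjNormal (φ (k : P)) a) :
    ContH1 φ A L →* ContH1 φ A K :=
  QuotientGroup.map _ _ (retractCocycle φ A ψ hψc hψ) (by
    intro f hf
    obtain ⟨a, ha⟩ := (mem_contCoboundaries_iff _).mp (Subgroup.mem_subgroupOf.mp hf)
    refine Subgroup.mem_subgroupOf.mpr ((mem_contCoboundaries_iff _).mpr ⟨a, ?_⟩)
    funext k
    have h := congrFun ha (ψ k)
    change f.1 (ψ k) = MulAut.conjNormal (φ (k : P)) a * a⁻¹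
    rw [h, hψ])

/-- `retractH1` on the class of a cocycle. [cite: NeukirchSchmidtWingberg2008, I §5] -/
theorem retractH1_mk {K L : Subgroup P} (ψ : K →* L) (hψc : Continuous ψ)
    (hψ : ∀ (k : K) (a : A), MulAut.conjNormal (φ ((ψ k : L) : P)) a = MulAut.conjNormal (φ (k : P)) a)
    (f : contCocycles φ A L) :
    retractH1 φ A ψ hψc hψ (QuotientGroup.mk f) = QuotientGroup.mk (retractCocycle φ A ψ hψc hψ f) :=
  rfl

/-- Pull-backs along two homomorphisms with the SAME underlying map to `Π` on a smaller source agree after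
restriction: for `K₂ ≤ K₁`, `ψ₁ : K₁ → L₁`, `ψ₂ : K₂ → L₂` with `L₂ ≤ L₁` and `ψ₁ k = ψ₂ k` in `Π` for `k ∈ K₂`,
`res_{K₂ ≤ K₁} (ψ₁^* x) = ψ₂^* (res_{L₂ ≤ L₁} x)` (compatibility of the pull-backs with the transition maps).
[cite: NeukirchSchmidtWingberg2008, I §5] -/
theorem res_retractH1 {K₁ K₂ L₁ L₂ : Subgroup P} (hK : K₂ ≤ K₁) (hL : L₂ ≤ L₁)
    (ψ₁ : K₁ →* L₁) (hψ₁c : Continuous ψ₁)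
    (hψ₁ : ∀ (k : K₁) (a : A), MulAut.conjNormal (φ ((ψ₁ k : L₁) : P)) a = MulAut.conjNormal (φ (k : P)) a)
    (ψ₂ : K₂ →* L₂) (hψ₂c : Continuous ψ₂)
    (hψ₂ : ∀ (k : K₂) (a : A), MulAut.conjNormal (φ ((ψ₂ k : L₂) : P)) a = MulAut.conjNormal (φ (k : P)) a)
    (heq : ∀ k : K₂, ((ψ₁ (Subgroup.inclusion hK k) : L₁) : P) = ((ψ₂ k : L₂) : P))
    (x : ContH1 φ A L₁) :
    ContH1.res φ A hK (retractH1 φ A ψ₁ hψ₁c hψ₁ x) = retractH1 φ A ψ₂ hψ₂c hψ₂ (ContH1.res φ A hL x) := by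
  induction x using QuotientGroup.induction_on with
  | H f =>
    change QuotientGroup.mk (ContH1.resCocycle φ A hK (retractCocycle φ A ψ₁ hψ₁c hψ₁ f)) =
      QuotientGroup.mk (retractCocycle φ A ψ₂ hψ₂c hψ₂ (ContH1.resCocycle φ A hL f))
    congr 1
    apply Subtype.ext
    funext k
    change f.1 (ψ₁ ⟨k.1, hK k.2⟩) = f.1 ⟨((ψ₂ k : L₂) : P), hL (ψ₂ k).2⟩
    exact congrArg f.1 (Subtype.ext (heq k))

/-- The SECTION PROPERTY at a finite level: if `K₀ ≤ K` lies inside `L` and `ψ : K → L` is the identity on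
`K₀` (in `Π`), then restricting the pull-back `ψ^* x` to `K₀` gives the restriction of `x` to `K₀`.
[cite: NeukirchSchmidtWingberg2008, I §5] -/
theorem res_retractH1_of_fixed {K K₀ L : Subgroup P} (hK : K₀ ≤ K) (hL : K₀ ≤ L)
    (ψ : K →* L) (hψc : Continuous ψ)
    (hψ : ∀ (k : K) (a : A), MulAut.conjNormal (φ ((ψ k : L) : P)) a = MulAut.conjNormal (φ (k : P)) a)
    (hfix : ∀ k : K₀, ((ψ (Subgroup.inclusion hK k) : L) : P) = k) (x : ContH1 φ A L) :
    ContH1.res φ A hK (retractH1 φ A ψ hψc hψ x) = ContH1.res φ A hL x := by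
  induction x using QuotientGroup.induction_on with
  | H f =>
    change QuotientGroup.mk (ContH1.resCocycle φ A hK (retractCocycle φ A ψ hψc hψ f)) =
      QuotientGroup.mk (ContH1.resCocycle φ A hL f)
    congr 1
    apply Subtype.ext
    funext k
    change f.1 (ψ ⟨k.1, hK k.2⟩) = f.1 ⟨k.1, hL k.2⟩
    exact congrArg f.1 (Subtype.ext (hfix k))

/-! ### Retraction data for `D ≤ H` along the levels of the system over `⊥` -/

/-- **Level retractions** for subgroups `D ≤ H` of `Π` (DATA; at the model `H = Π_Ÿ(Π)`, `D = D_{μ_-}`): for every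
finite-index open level `K` a DEEPER level `lift K ⊆ K` (at the model `K ∩ q⁻¹(q(D ∩ K))`, `q : Π ↠ G_k`),
monotonically, and a continuous homomorphism `ψ_K : H ∩ lift K → D ∩ K` (at the model `k ↦` the unique `d ∈ D ∩ K`
with `q(d) = q(k)` — `D ∩ Ker(q) = 1` for the decomposition group of a closed point) such that `k` and `ψ_K(k)` act
identically on the coefficients (`Ker(q)` acts trivially on `(l·Δ_Θ)(Π)`: `Δ_Θ` is central in `Δ^Θ`, [EtTh] §1
p. 12), the `ψ_K` are compatible along the levels, and `ψ_K` is the identity on `D ∩ lift K`. No claim of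
[IUTchII] is encoded; these are the elementary inputs of the inflation section below. [cite: Mochizuki2012, Cor 1.12 (c) p.56] -/
structure LevelRetraction (H D : Subgroup P) : Type u where
  /-- the deeper level `lift K ⊆ K` on which the retraction to `D ∩ K` is defined -/
  lift : Idx (P := P) ⊥ → Idx (P := P) ⊥
  le_lift : ∀ i, i ≤ lift i
  lift_mono : ∀ ⦃i j : Idx (P := P) ⊥⦄, i ≤ j → lift i ≤ lift j
  /-- the retraction `H ∩ lift K → D ∩ K` -/
  ψ : ∀ i, ↥(H ⊓ (lift i).K) →* ↥(D ⊓ i.K)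
  ψ_continuous : ∀ i, Continuous (ψ i)
  /-- `k` and `ψ_K(k)` act identically on the coefficients `A` -/
  ψ_act : ∀ i (k : ↥(H ⊓ (lift i).K)) (a : A),
    MulAut.conjNormal (φ ((ψ i k : ↥(D ⊓ i.K)) : P)) a = MulAut.conjNormal (φ (k : P)) a
  /-- compatibility along `K_j ⊆ K_i`: the retractions agree in `Π` -/
  ψ_compat : ∀ ⦃i j : Idx (P := P) ⊥⦄ (hij : i ≤ j) (k : ↥(H ⊓ (lift j).K)),
    ((ψ i (Subgroup.inclusion (inf_le_inf_left H (Idx.le_iff.mp (lift_mono hij))) k) : ↥(D ⊓ i.K)) : P) =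
      ((ψ j k : ↥(D ⊓ j.K)) : P)
  /-- `ψ_K` is the identity on `D ∩ lift K` -/
  ψ_id : ∀ i (k : ↥(H ⊓ (lift i).K)), (k : P) ∈ D → ((ψ i k : ↥(D ⊓ i.K)) : P) = k

namespace LevelRetraction

variable {φ A} {H D : Subgroup P} (R : LevelRetraction φ A H D)

/-- The section on the members: `H¹(D ∩ K, A) → H¹(H ∩ lift K, A)`, pull-back along `ψ_K`.
[cite: Mochizuki2012, Cor 1.12 (c) p.56] -/
def sectionGmod (i : Idx (P := P) ⊥) : Gmod φ A D ⊥ i →+ Gmod φ A H ⊥ (R.lift i) :=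
  MonoidHom.toAdditive (retractH1 φ A (R.ψ i) (R.ψ_continuous i) (R.ψ_act i))

/-- Compatibility of the member sections with the transition maps of the two systems.
[cite: Mochizuki2012, Cor 1.12 (c) p.56] -/
theorem sectionGmod_fmod {i j : Idx (P := P) ⊥} (hij : i ≤ j) (x : Gmod φ A D ⊥ i) :
    R.sectionGmod j (fmod φ A D ⊥ i j hij x) =
      fmod φ A H ⊥ (R.lift i) (R.lift j) (R.lift_mono hij) (R.sectionGmod i x) := by
  change Additive.ofMul (retractH1 φ A (R.ψ j) (R.ψ_continuous j) (R.ψ_act j)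
      (ContH1.res φ A (inf_le_inf_left D (Idx.le_iff.mp hij)) (Additive.toMul x))) =
    Additive.ofMul (ContH1.res φ A (inf_le_inf_left H (Idx.le_iff.mp (R.lift_mono hij)))
      (retractH1 φ A (R.ψ i) (R.ψ_continuous i) (R.ψ_act i) (Additive.toMul x)))
  rw [res_retractH1 φ A (inf_le_inf_left H (Idx.le_iff.mp (R.lift_mono hij)))
    (inf_le_inf_left D (Idx.le_iff.mp hij)) (R.ψ i) (R.ψ_continuous i) (R.ψ_act i)
    (R.ψ j) (R.ψ_continuous j) (R.ψ_act j) (R.ψ_compat hij)]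

/-- **The inflation section** `lim_K H¹(D|_K, A) → lim_K H¹(H|_K, A)` of the restriction along `D ≤ H` (DEFINED by
the universal property of the direct limit from the compatible member sections) — CMR's `inclHd` at the model:
"a natural inclusion of `M^×_TM(Π)` [and of all of `lim_J H¹(D|_J, (l·Δ_Θ)(Π))`] into the inductive limit of the
first line". [cite: Mochizuki2012, Cor 1.12 (c) p.56] -/
def h1LimSection : h1Lim φ A D ⊥ →+ h1Lim φ A H ⊥ :=
  AddCommGroup.DirectLimit.lift (Gmod φ A D ⊥) (fmod φ A D ⊥) (h1Lim φ A H ⊥)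
    (fun i => (h1Of φ A H ⊥ (R.lift i)).comp (R.sectionGmod i))
    (fun i j hij x => by
      change h1Of φ A H ⊥ (R.lift j) (R.sectionGmod j (fmod φ A D ⊥ i j hij x)) =
        h1Of φ A H ⊥ (R.lift i) (R.sectionGmod i x)
      rw [sectionGmod_fmod, h1Of_fmod])

/-- `h1LimSection` on generators. [cite: Mochizuki2012, Cor 1.12 (c) p.56] -/
@[simp] theorem h1LimSection_of (i : Idx (P := P) ⊥) (x : Gmod φ A D ⊥ i) :
    R.h1LimSection (h1Of φ A D ⊥ i x) = h1Of φ A H ⊥ (R.lift i) (R.sectionGmod i x) :=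
  AddCommGroup.DirectLimit.lift_of (G := Gmod φ A D ⊥) (f := fmod φ A D ⊥) _ _ _ i x

/-- At a finite level the restriction to `D` of the member section is the transition map of the `D`-system:
`res_{D ∩ lift K ≤ H ∩ lift K} (ψ_K^* x) = res_{D ∩ lift K ≤ D ∩ K} x` (`ψ_K` is the identity on `D ∩ lift K`).
[cite: Mochizuki2012, Cor 1.12 (ii) p.57] -/
theorem gmodRestrict_sectionGmod (hDH : D ≤ H) (i : Idx (P := P) ⊥) (x : Gmod φ A D ⊥ i) :
    gmodRestrict φ A hDH ⊥ (R.lift i) (R.sectionGmod i x) = fmod φ A D ⊥ i (R.lift i) (R.le_lift i) x := by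
  change Additive.ofMul (ContH1.res φ A (inf_le_inf_right (R.lift i).K hDH)
      (retractH1 φ A (R.ψ i) (R.ψ_continuous i) (R.ψ_act i) (Additive.toMul x))) =
    Additive.ofMul (ContH1.res φ A (inf_le_inf_left D (Idx.le_iff.mp (R.le_lift i))) (Additive.toMul x))
  rw [res_retractH1_of_fixed φ A (inf_le_inf_right (R.lift i).K hDH)
    (inf_le_inf_left D (Idx.le_iff.mp (R.le_lift i))) (R.ψ i) (R.ψ_continuous i) (R.ψ_act i)
    (fun k => R.ψ_id i _ k.2.1)]

/-- **`h1LimSection` IS A SECTION of the restriction to `D`**: `h1LimRestrict ∘ h1LimSection = id` on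
`lim_K H¹(D|_K, A)` — at the model: restricting to `D_{μ_-}` an inflated class of the constants returns the class
(the content of "restriction to `D` … `→ M^×_TM(Π)`" on the unit classes, Cor. 1.12 (ii)).
[cite: Mochizuki2012, Cor 1.12 (ii) p.57] -/
theorem h1LimRestrict_h1LimSection (hDH : D ≤ H) (x : h1Lim φ A D ⊥) :
    h1LimRestrict φ A hDH ⊥ (R.h1LimSection x) = x := by
  have h : (h1LimRestrict φ A hDH ⊥).comp R.h1LimSection = AddMonoidHom.id _ :=
    h1Lim_hom_ext φ A D fun i y => by
      rw [AddMonoidHom.comp_apply, AddMonoidHom.id_apply, h1LimSection_of, h1LimRestrict_of,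
        gmodRestrict_sectionGmod R hDH, h1Of_fmod]
  exact DFunLike.congr_fun h x

/-- Hence the inflation section is INJECTIVE ("a natural inclusion … into the inductive limit of the first line",
Cor. 1.12 (c)) … [cite: Mochizuki2012, Cor 1.12 (c) p.56] -/
theorem h1LimSection_injective (hDH : D ≤ H) : Function.Injective R.h1LimSection :=
  Function.LeftInverse.injective (R.h1LimRestrict_h1LimSection hDH)

include R in
/-- … and the restriction `lim_K H¹(H|_K, A) → lim_K H¹(D|_K, A)` is SURJECTIVE.
[cite: Mochizuki2012, Cor 1.12 (ii) p.57] -/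
theorem h1LimRestrict_surjective (hDH : D ≤ H) : Function.Surjective (h1LimRestrict φ A hDH ⊥) :=
  Function.RightInverse.surjective (R.h1LimRestrict_h1LimSection hDH)

/-- The composite `h1LimSection ∘ h1LimRestrict` is idempotent (a projector of the first line onto the inflated
`D`-classes). [cite: Mochizuki2012, Cor 1.12 (ii) p.57] -/
theorem h1LimSection_h1LimRestrict_idem (hDH : D ≤ H) (x : h1Lim φ A H ⊥) :
    R.h1LimSection (h1LimRestrict φ A hDH ⊥ (R.h1LimSection (h1LimRestrict φ A hDH ⊥ x))) =
      R.h1LimSection (h1LimRestrict φ A hDH ⊥ x) := by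
  rw [R.h1LimRestrict_h1LimSection hDH]

end LevelRetraction

end CohomologySystemOfContH1

end

end Literature.IUT.HodgeArakelov
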